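/-
Copyright (c) 2026 the pub-hodgecm-mathlib formalisation cell (harness21).  Prover seat hodgecm-mathlib-K2Liu-p08 (g4), Track B «K2-LIT» ∕ hLiu418
#184♮, socket #42S organ S1 (ROAD W), brick F8 (K-tot)-split (LEAD BATCH #23 «p08 split twin»; the split twin of K2Liu-p01 (g9)'s (K-tot)
`K2LiuInertWitnessCoordinate`).  2026-09-04.  KERNEL: theorems only.
-/
import Summits.HodgeConjecture.HodgeConjecture.Theorems.K2LiuWitnessFrameCoordinateContinuous   -- ★ p860530 `exists_frame_homeomorph` ((K1)(K2)(K3))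
import Summits.HodgeConjecture.HodgeConjecture.Theorems.K2LiuWitnessFrameCoordinateSplit        -- ★ p860240 `exists_split_frame`, `exists_split_regroup`
import Literature.NumberTheory.Automorphic.UnitaryGroupLocalFactors                             -- ★ `continuous_conjLocal`
import HarnessLib

/-!
# Crux `HLiu418`, #42S-S1 ROAD W, brick (K-tot)-split: THE TOTAL WITNESS COORDINATE AT A SPLIT PLACE `Y ≃ (Fin 2 → E⊗F_v)³ ≃ (Fin 2 → E_{w₀})⁶`

Cell `hodgecm-mathlib`, crux item hLiu418 = `stmt-HodgeConjecture-24832` (helper lane `--supports … --as helper`, count-neutral).  THEOREMS ONLY (no `def`, no instance,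
no notation, no named-fact hypothesis, no `sorry`).  The SPLIT twin of (K-tot): from ★ κ₀ (Y-model ↦ `b`, continuous both ways, BY VALUE), the tensor index `e`, and the
diagonal Gram `D` (`σD = D`, `Dᵀ = D`, `det D` a unit) we produce, at a place `v` SPLIT in `E∕F` (`w₀`, `c • w₀ ≠ w₀`):  the frame coordinate `κ : Y ≃+ (Fin 2 → E⊗F_v)³`
(★ `exists_frame_homeomorph` with the split frame `P` of ★ `exists_split_frame` at `d := 1` — a homeomorphism) and the regrouping `θ : (Fin 2 → E⊗F_v)³ ≃+ (Fin 2 → E_{w₀})⁶`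
(★ `exists_split_regroup`, continuous), with
* (K2-R) `G̃(x) = hypGram_1(κ x)` over `E ⊗ F_v` (the letter of ★ (W1-b)∕(W1-c)∕(Φ8)), and
* (hK2) **`G̃(x)_{ji}(w₀) = K(θ κ x)_{ji}`, `(σ G̃(x)_{ji})(w₀) = K(θ κ x)_{ij}`**, `K(y) = A′B″ᵀ + B′A″ᵀ + 1·C′C″ᵀ` on `y = (B″,B′,A′,A″,C′,C″)` — EXACTLY the letter `hK2` of
  ★ (W2-c)-split `K2LiuSplitWitnessDualitySet` (with `dK := 1`) and, with `ρ := θ ∘ κ`, the frame of ★ (J)-split ∕ ★ (γ1)-split (`vd := 0`).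
[Shimura1997, §13.2] [Scharlau1985HermitianForms, Ch. 7 §1] [CasselsFrohlichANT1967, Ch. II §10].
HONEST LABEL.  Count-neutral helper; `HC_CM` is proved only modulo the 7 printed citations (2 remaining named inputs: hLiu418 = `stmt-HodgeConjecture-24832`,
h413 = `stmt-HodgeConjecture-24833`) until rung 0 closes.

## References
* [Shimura1997] G. Shimura, CBMS 93 (1997), §13.2.   * [Scharlau1985HermitianForms] W. Scharlau, Grundlehren 270 (1985), Ch. 7 §1.
* [CasselsFrohlichANT1967] Cassels–Fröhlich (1967), Ch. II §10.
-/

set_option autoImplicit false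
set_option linter.dupNamespace false -- the mandated namespace repeats `HodgeConjecture.HodgeConjecture`

open Matrix
open Literature.NumberTheory.Automorphic Literature.NumberTheory.Automorphic.UnitaryGroup

namespace Summit.HodgeConjecture.HodgeConjecture.Cruxes.HLiu418.K2LiuSplitWitnessCoordinate

open K2LiuWitnessFrameCoordinateContinuous K2LiuWitnessFrameCoordinateSplit K2LiuLocalRingSplitReading

variable {F E : Type} [Field F] [NumberField F] [Field E] [NumberField E] [Algebra F E] [Algebra.IsQuadraticExtension F E]
  (c : E ≃ₐ[F] E) {δ : E} (hcδ : c δ = -δ) (hδ : δ ≠ 0) (v : IsDedekindDomain.HeightOneSpectrum (NumberField.RingOfIntegers F))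
  (w₀ : PlacesOver E v) (hw₀ : c • w₀.1 ≠ w₀.1)

include hcδ hδ hw₀ in
/-- **THE TOTAL WITNESS COORDINATE AT A SPLIT PLACE.** [cite: Shimura1997, §13.2] [cite: Scharlau1985HermitianForms, Ch. 7 §1] -/
theorem exists_split_witness_coordinate {Y : Type*} [AddCommGroup Y] [TopologicalSpace Y] {ι' : Type*} (κ₀ : Y ≃+ (ι' → LocalRing E v))
    (hκ₀ : Continuous κ₀) (hκ₀' : Continuous κ₀.symm) (e : Fin 2 × Fin 3 ≃ ι')
    {D : Matrix (Fin 3) (Fin 3) (LocalRing E v)} (hD : D.map (conjLocal E c v) = D) (hDt : Dᵀ = D) (hDu : IsUnit D.det) :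
    ∃ (κ : Y ≃+ (Fin 2 → LocalRing E v) × (Fin 2 → LocalRing E v) × (Fin 2 → LocalRing E v))
      (θ : ((Fin 2 → LocalRing E v) × (Fin 2 → LocalRing E v) × (Fin 2 → LocalRing E v)) ≃+ ((Fin 2 → (w₀.1).adicCompletion E) × (Fin 2 → (w₀.1).adicCompletion E) × (Fin 2 → (w₀.1).adicCompletion E) × (Fin 2 → (w₀.1).adicCompletion E) × (Fin 2 → (w₀.1).adicCompletion E) × (Fin 2 → (w₀.1).adicCompletion E))),
      Continuous κ ∧ Continuous κ.symm ∧ Continuous θ ∧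
      (∀ t, θ t = (fun j => conjLocal E c v (t.2.1 j) w₀, fun j => t.2.1 j w₀, fun j => t.1 j w₀, fun j => conjLocal E c v (t.1 j) w₀,
          fun j => t.2.2 j w₀, fun j => conjLocal E c v (t.2.2 j) w₀)) ∧
      (∀ x j i, (∑ k, ∑ l, κ₀ x (e (j, l)) * D k l * conjLocal E c v (κ₀ x (e (i, k)))) =
        (vecMulVec (κ x).1 (fun r => conjLocal E c v ((κ x).2.1 r)) + vecMulVec (κ x).2.1 (fun r => conjLocal E c v ((κ x).1 r)) +
          (1 : LocalRing E v) • vecMulVec (κ x).2.2 (fun r => conjLocal E c v ((κ x).2.2 r))) j i) ∧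
      (∀ x j i, (∑ k, ∑ l, κ₀ x (e (j, l)) * D k l * conjLocal E c v (κ₀ x (e (i, k)))) w₀ = (vecMulVec (θ (κ x)).2.2.1 (θ (κ x)).1 + vecMulVec (θ (κ x)).2.1 (θ (κ x)).2.2.2.1 + (1 : (w₀.1).adicCompletion E) • vecMulVec (θ (κ x)).2.2.2.2.1 (θ (κ x)).2.2.2.2.2) j i ∧
        conjLocal E c v (∑ k, ∑ l, κ₀ x (e (j, l)) * D k l * conjLocal E c v (κ₀ x (e (i, k)))) w₀ = (vecMulVec (θ (κ x)).2.2.1 (θ (κ x)).1 + vecMulVec (θ (κ x)).2.1 (θ (κ x)).2.2.2.1 + (1 : (w₀.1).adicCompletion E) • vecMulVec (θ (κ x)).2.2.2.2.1 (θ (κ x)).2.2.2.2.2) i j) := by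
  -- the split frame with `d := 1`, the frame coordinate (a homeomorphism), the regrouping
  obtain ⟨P, hPdet, hP⟩ := exists_split_frame c hcδ hδ v w₀ hw₀ hD hDt hDu (d := 1) (map_one _) isUnit_one
  obtain ⟨κ, h1, h2, hc, hc'⟩ := exists_frame_homeomorph κ₀ hκ₀ hκ₀' e (conjLocal E c v) hPdet hP
  obtain ⟨θ, hθ⟩ := exists_split_regroup c hcδ hδ v w₀ hw₀
  have hθc : Continuous θ := by
    have hfun : (θ : ((Fin 2 → LocalRing E v) × (Fin 2 → LocalRing E v) × (Fin 2 → LocalRing E v)) → ((Fin 2 → (w₀.1).adicCompletion E) × (Fin 2 → (w₀.1).adicCompletion E) × (Fin 2 → (w₀.1).adicCompletion E) × (Fin 2 → (w₀.1).adicCompletion E) × (Fin 2 → (w₀.1).adicCompletion E) × (Fin 2 → (w₀.1).adicCompletion E))) = fun t => (fun j => conjLocal E c v (t.2.1 j) w₀, fun j => t.2.1 j w₀, fun j => t.1 j w₀, fun j => conjLocal E c v (t.1 j) w₀,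
          fun j => t.2.2 j w₀, fun j => conjLocal E c v (t.2.2 j) w₀) := funext hθ
    rw [hfun]
    have hσ := continuous_conjLocal E c v
    refine ((continuous_pi fun j => (continuous_apply w₀).comp (hσ.comp ((continuous_apply j).comp (continuous_fst.comp continuous_snd))))).prodMk
      (((continuous_pi fun j => (continuous_apply w₀).comp ((continuous_apply j).comp (continuous_fst.comp continuous_snd)))).prodMk
      (((continuous_pi fun j => (continuous_apply w₀).comp ((continuous_apply j).comp continuous_fst))).prodMk
      (((continuous_pi fun j => (continuous_apply w₀).comp (hσ.comp ((continuous_apply j).comp continuous_fst)))).prodMk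
      (((continuous_pi fun j => (continuous_apply w₀).comp ((continuous_apply j).comp (continuous_snd.comp continuous_snd)))).prodMk
      (continuous_pi fun j => (continuous_apply w₀).comp (hσ.comp ((continuous_apply j).comp (continuous_snd.comp continuous_snd))))))))
  refine ⟨κ, θ, hc, hc', hθc, hθ, h2, fun x j i => ⟨?_, ?_⟩⟩
  · rw [h2 x j i, hθ]
    dsimp only
    rw [reading_gram_fst c v w₀ (κ x).1 (κ x).2.1 (κ x).2.2 j i, Pi.one_apply]
  · rw [h2 x j i, hθ]
    dsimp only
    rw [reading_gram_snd c hcδ hδ v w₀ (map_one _) (κ x).1 (κ x).2.1 (κ x).2.2 j i, Pi.one_apply]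

end Summit.HodgeConjecture.HodgeConjecture.Cruxes.HLiu418.K2LiuSplitWitnessCoordinate
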